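import Literature.AlgebraicGeometry.Resolution.AffineBlowupAlgebra
import HarnessLib

/-!
# The chart over `h` of the blow-up of affine space along `V(X_i (i ∈ A), h)` is an affine space

Topic: `Literature/AlgebraicGeometry/Resolution`. Companion of `CoordinateBlowupChart.lean` (the
standard charts of the blow-up of `𝔸^σ_S` along a COORDINATE subspace `V(X_i : i ∈ A)` are affine
spaces, Hu 2025 Prop. 5.3). Here the centre is the intersection of a coordinate subspace with a
HYPERSURFACE: `Z = V(X_i : i ∈ A) ∩ V(h)` for a polynomial `h ∈ S[X_σ]` not involving the
variables `X_i`, `i ∈ A`, and a non-zero-divisor. This is the shape of the **`ℓ`-blow-ups** of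
Y. Hu, *Universal characteristic-free resolution of singularities, I* (arXiv:2507.21400), §2.5.4
and §6: the centre is `D_{℘_k,L_F} ∩ E_{℘_k,ϑ_k}`, on a chart `(L = 0) ∩ (δ = 0)` with `δ` the
exceptional (coordinate) variable and `L = sgn(s_F) δ + h`, `h = Σ_{s ≠ s_F} sgn(s) x_{(u_s,v_s)}`
free of `δ`, so that `(L, δ) = (h, δ)`:

> "the proper transform of `L_{F_k}` on the chart `𝔙` can take of the form
> `L_{F_k} : sgn(s_{F_k}) δ_{𝔙,(𝔪,u_{F_k})} + Σ_{s ∈ S_{F_k} ∖ s_{F_k}} sgn(s) x_{(u_s,v_s)}` … let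
> `R̃_{ℓ_k} → R̃_{℘_k}` be the blowup of `R̃_{℘_k}` along the intersection
> `D_{℘_k,L_{F_k}} ∩ E_{℘_k,ϑ_k}`. Then, the blowup will eliminate that "zero factor"
> `δ_{𝔙,(𝔪,u_{F_k})}` and bring up a variable `y_{(𝔪,u_{F_k})}` invertible along `Ṽ_{ℓ_k}`. …
> `Ṽ_{ℓ_k}` is contained in the proper transform of `D_{℘_k,L_{F_k}}`." (§2.5.4)
> "we can choose the chart `𝔙` such that `L_{𝔙,F} = 1 + sgn(s_F) y_{𝔙,(𝔪,u_F)}`" (§8.3)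

PROVED here, over any commutative ring `S`, for `I = (X_i : i ∈ A) + (h)`:

* `hypBlowupSubst S A h : S[X_σ] →ₐ[S] S[X_σ]` — the substitution `X_i ↦ h · X_i` (`i ∈ A`),
  `X_j ↦ X_j` otherwise; it fixes `h` (`hypBlowupSubst_self`, `h` free of the `X_i`, `i ∈ A`) and
  carries `I` onto the principal ideal `(h)` (`map_hypBlowupSubst_ideal_eq`: **the exceptional
  divisor of the chart is `(h = 0)`**);
* `hypBlowupChartMap S A h : S[X_σ] →ₐ[S] S[X_σ][1/h]` — `X_i ↦ X_i / h` (`i ∈ A`); **chart map ∘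
  substitution = localisation map** (`hypBlowupChartMap_comp_hypBlowupSubst`), the chart map is
  injective for `h` a non-zero-divisor (`hypBlowupChartMap_injective`, retraction argument) and
  its image is exactly the affine blowup algebra `S[X_σ][I/h]` (`range_hypBlowupChartMap`);
* `hypBlowupChartEquiv S A h : S[X_σ] ≃ₐ[S] S[X_σ][I/h]` — **the chart of `Bl_Z 𝔸^σ_S` over the
  generator `h` is again the affine space `𝔸^σ_S`**, with free variables `y_i := X_i/h`
  (`i ∈ A`) and the old `X_j`; under it the structure map is `hypBlowupSubst`
  (`hypBlowupChartEquiv_hypBlowupSubst`, `hypBlowupChartEquiv_symm_algebraMap`);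
  `hypBlowupReesChartEquiv` — the same for the chart ring `(R[It])_{(h t)}` of `Proj R[It]`;
* Hu's bookkeeping on this chart for `A ∋ j₀` (the `δ` above) and `L = c X_{j₀} + h`:
  `hypBlowupSubst_C_mul_X_add` — **`π* L = h · (c y + 1)`**, i.e. the proper transform of `L` is
  `1 + c y` ("`L_{𝔙,F} = 1 + sgn(s_F) y`"); `span_X_sup_span_C_mul_X_add_one_eq_top` — **the
  proper transforms `(y = 0)` of `(δ = 0)` and `(c y + 1 = 0)` of `(L = 0)` are disjoint** ("this
  process separates the two divisors"); `isUnit_mk_X_of_C_mul_X_add_one` — `y` is a unit along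
  `(c y + 1 = 0)` ("a variable invertible along `Ṽ_{ℓ_k}`").

No named facts (D-0026). The other chart of this blow-up (over the generator `X_{j₀}`) is NOT an
affine space in general; Hu only uses the chart over `L` (equivalently over `h`), which contains
the whole proper transform of `D_L`.

## References

* Y. Hu, *Universal Characteristic-free Resolution of Singularities, I*, arXiv:2507.21400 (2025),
  §2.5.4, §5 Def. 5.1–5.2 and Prop. 5.3, §8.3 (theorem numbers of the arXiv v1 TeX source). [Hu2025]
* The Stacks Project, Tags 052P, 052Q, 0804 (affine blowup algebras; charts of a blowing up). [StacksProject]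
* U. Görtz, T. Wedhorn, *Algebraic Geometry I*, 2nd ed. (2020), (13.19) p. 415. [GortzWedhorn2020]
-/

noncomputable section

open MvPolynomial IsLocalization

namespace Literature.AlgebraicGeometry.Resolution

universe u v

variable (S : Type u) [CommRing S] {σ : Type v} (A : Set σ) (h : MvPolynomial σ S)

/-- The centre ideal `I = (X_i : i ∈ A) + (h)` of `Z = V(X_i : i ∈ A) ∩ V(h)`. [folklore] -/
abbrev hypCentreIdeal : Ideal (MvPolynomial σ S) := Ideal.span (X '' A) ⊔ Ideal.span {h}

/-- `h ∈ I`. [folklore] -/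
theorem self_mem_hypCentreIdeal : h ∈ hypCentreIdeal S A h :=
  Ideal.mem_sup_right (Ideal.subset_span rfl)

/-- `X_i ∈ I` for `i ∈ A`. [folklore] -/
theorem X_mem_hypCentreIdeal {i : σ} (hi : i ∈ A) : (X i : MvPolynomial σ S) ∈ hypCentreIdeal S A h :=
  Ideal.mem_sup_left (Ideal.subset_span ⟨i, hi, rfl⟩)

/-! ### The substitution `X_i ↦ h · X_i` (`i ∈ A`) -/

open Classical in
/-- **The blow-up substitution** `X_i ↦ h · X_i` for `i ∈ A`, `X_j ↦ X_j` otherwise (Hu: on the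
chart over `L` of the `ℓ`-blow-up, `δ = L' · y` with `y` the new free variable).
[cite: Hu2025, §2.5.4 and §5 Prop. 5.3] -/
def hypBlowupSubst : MvPolynomial σ S →ₐ[S] MvPolynomial σ S :=
  aeval fun i => if i ∈ A then h * X i else X i

open Classical in
/-- The substitution on a variable. [cite: Hu2025, §5 Prop. 5.3] -/
theorem hypBlowupSubst_X (i : σ) :
    hypBlowupSubst S A h (X i) = if i ∈ A then h * X i else X i := by
  simp [hypBlowupSubst]

/-- `X_i ↦ h X_i` on the coordinate variables of the centre. [cite: Hu2025, §5 Prop. 5.3] -/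
@[simp] theorem hypBlowupSubst_X_of_mem {i : σ} (hi : i ∈ A) :
    hypBlowupSubst S A h (X i) = h * X i := by
  rw [hypBlowupSubst_X, if_pos hi]

/-- `X_j ↦ X_j` off the coordinate variables of the centre. [cite: Hu2025, §5 Prop. 5.3] -/
@[simp] theorem hypBlowupSubst_X_of_not_mem {i : σ} (hi : i ∉ A) :
    hypBlowupSubst S A h (X i) = X i := by
  rw [hypBlowupSubst_X, if_neg hi]

/-- Constants are fixed. [folklore] -/
@[simp] theorem hypBlowupSubst_C (c : S) : hypBlowupSubst S A h (C c) = C c :=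
  (hypBlowupSubst S A h).commutes c

/-- A polynomial not involving the variables `X_i`, `i ∈ A`, is fixed by the substitution.
[folklore] -/
theorem hypBlowupSubst_of_forall_not_mem_vars {p : MvPolynomial σ S} (hp : ∀ i ∈ A, i ∉ p.vars) :
    hypBlowupSubst S A h p = p := by
  change (hypBlowupSubst S A h : MvPolynomial σ S →+* MvPolynomial σ S) p =
    (RingHom.id (MvPolynomial σ S)) p
  refine MvPolynomial.hom_congr_vars ?_ (fun i hi _ => ?_) rfl
  · ext c
    simp
  · have hiA : i ∉ A := fun hiA => hp i hiA hi
    simp [hiA]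

variable {h} in
/-- **`h` is fixed** (it does not involve the `X_i`, `i ∈ A`). [cite: Hu2025, §2.5.4] -/
@[simp] theorem hypBlowupSubst_self (hh : ∀ i ∈ A, i ∉ h.vars) : hypBlowupSubst S A h h = h :=
  hypBlowupSubst_of_forall_not_mem_vars S A h hh

variable {h} in
/-- **The exceptional divisor of the chart is `(h = 0)`**: the substitution carries
`I = (X_i : i ∈ A) + (h)` onto the principal ideal `(h)` (Stacks 07Z3 (2): `I · R[I/a] = a R[I/a]`).
[cite: Hu2025, §5 Prop. 5.3] [cite: StacksProject, Tag 052P] -/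
theorem map_hypBlowupSubst_ideal_eq (hh : ∀ i ∈ A, i ∉ h.vars) :
    (hypCentreIdeal S A h).map (hypBlowupSubst S A h) = Ideal.span {h} := by
  apply le_antisymm
  · rw [Ideal.map_sup, Ideal.map_span, Ideal.map_span, Set.image_singleton,
      hypBlowupSubst_self S A hh, sup_le_iff]
    refine ⟨?_, le_rfl⟩
    rw [Ideal.span_le]
    rintro _ ⟨_, ⟨i, hi, rfl⟩, rfl⟩
    change hypBlowupSubst S A h (X i) ∈ Ideal.span {h}
    rw [hypBlowupSubst_X_of_mem S A h hi]
    exact Ideal.mul_mem_right _ _ (Ideal.subset_span rfl)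
  · rw [Ideal.span_le, Set.singleton_subset_iff]
    have hm := Ideal.mem_map_of_mem (hypBlowupSubst S A h) (self_mem_hypCentreIdeal S A h)
    rwa [hypBlowupSubst_self S A hh] at hm

/-! ### The chart map `X_i ↦ X_i / h` -/

open Classical in
/-- **The chart map** `S[X_σ] → S[X_σ][1/h]`: `X_i ↦ X_i / h` for `i ∈ A`, `X_j ↦ X_j` otherwise
(the free variables `y_i = X_i/h` of the chart over `h`). [cite: Hu2025, §5 Prop. 5.3]
[cite: GortzWedhorn2020, (13.19) p. 415] -/
def hypBlowupChartMap : MvPolynomial σ S →ₐ[S] Localization.Away h :=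
  aeval fun i => if i ∈ A then
    algebraMap (MvPolynomial σ S) (Localization.Away h) (X i) * Away.invSelf h
    else algebraMap (MvPolynomial σ S) (Localization.Away h) (X i)

open Classical in
/-- The chart map on a variable. [cite: Hu2025, §5 Prop. 5.3] -/
theorem hypBlowupChartMap_X (i : σ) :
    hypBlowupChartMap S A h (X i) = if i ∈ A then
      algebraMap (MvPolynomial σ S) (Localization.Away h) (X i) * Away.invSelf h
      else algebraMap (MvPolynomial σ S) (Localization.Away h) (X i) := by
  simp [hypBlowupChartMap]

/-- `X_i ↦ X_i / h` for `i ∈ A`. [cite: Hu2025, §5 Prop. 5.3] -/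
@[simp] theorem hypBlowupChartMap_X_of_mem {i : σ} (hi : i ∈ A) :
    hypBlowupChartMap S A h (X i) =
      algebraMap (MvPolynomial σ S) (Localization.Away h) (X i) * Away.invSelf h := by
  rw [hypBlowupChartMap_X, if_pos hi]

/-- `X_j ↦ X_j` for `j ∉ A`. [cite: Hu2025, §5 Prop. 5.3] -/
@[simp] theorem hypBlowupChartMap_X_of_not_mem {i : σ} (hi : i ∉ A) :
    hypBlowupChartMap S A h (X i) =
      algebraMap (MvPolynomial σ S) (Localization.Away h) (X i) := by
  rw [hypBlowupChartMap_X, if_neg hi]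

/-- The chart map on constants. [folklore] -/
@[simp] theorem hypBlowupChartMap_C (c : S) :
    hypBlowupChartMap S A h (C c) = algebraMap (MvPolynomial σ S) (Localization.Away h) (C c) := by
  rw [← MvPolynomial.algebraMap_eq, AlgHom.commutes]
  rfl

/-- A polynomial not involving the `X_i`, `i ∈ A`, goes to itself under the chart map. [folklore] -/
theorem hypBlowupChartMap_of_forall_not_mem_vars {p : MvPolynomial σ S}
    (hp : ∀ i ∈ A, i ∉ p.vars) :
    hypBlowupChartMap S A h p = algebraMap (MvPolynomial σ S) (Localization.Away h) p := by
  change (hypBlowupChartMap S A h : MvPolynomial σ S →+* Localization.Away h) p =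
    (algebraMap (MvPolynomial σ S) (Localization.Away h)) p
  refine MvPolynomial.hom_congr_vars ?_ (fun i hi _ => ?_) rfl
  · ext c
    simp only [RingHom.coe_comp, Function.comp_apply, RingHom.coe_coe, hypBlowupChartMap_C]
  · have hiA : i ∉ A := fun hiA => hp i hiA hi
    simp [hiA]

variable {h} in
/-- The chart map sends `h` to `h/1`. [folklore] -/
theorem hypBlowupChartMap_self (hh : ∀ i ∈ A, i ∉ h.vars) :
    hypBlowupChartMap S A h h = algebraMap (MvPolynomial σ S) (Localization.Away h) h :=
  hypBlowupChartMap_of_forall_not_mem_vars S A h hh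

variable {h} in
/-- **Chart map ∘ substitution = the localisation map `S[X_σ] → S[X_σ][1/h]`**
(`(X_i/h) · h = X_i`): the substitution is the structure map of the chart.
[cite: Hu2025, §5 Prop. 5.3] -/
theorem hypBlowupChartMap_comp_hypBlowupSubst (hh : ∀ i ∈ A, i ∉ h.vars) :
    (hypBlowupChartMap S A h).comp (hypBlowupSubst S A h) =
      IsScalarTower.toAlgHom S (MvPolynomial σ S) (Localization.Away h) := by
  refine MvPolynomial.algHom_ext fun i => ?_
  rw [AlgHom.comp_apply, IsScalarTower.toAlgHom_apply]
  by_cases hi : i ∈ A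
  · rw [hypBlowupSubst_X_of_mem S A h hi, map_mul, hypBlowupChartMap_self S A hh,
      hypBlowupChartMap_X_of_mem S A h hi, mul_comm, mul_assoc,
      mul_comm (Away.invSelf h), Away.mul_invSelf, mul_one]
  · rw [hypBlowupSubst_X_of_not_mem S A h hi, hypBlowupChartMap_X_of_not_mem S A h hi]

variable {h} in
/-- Pointwise form: `chart (subst p) = p/1`. [cite: Hu2025, §5 Prop. 5.3] -/
theorem hypBlowupChartMap_hypBlowupSubst (hh : ∀ i ∈ A, i ∉ h.vars) (p : MvPolynomial σ S) :
    hypBlowupChartMap S A h (hypBlowupSubst S A h p) =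
      algebraMap (MvPolynomial σ S) (Localization.Away h) p := by
  have h' := congrArg (fun φ => φ p) (hypBlowupChartMap_comp_hypBlowupSubst S A hh)
  simpa using h'

variable {h} in
/-- For `h` a non-zero-divisor, `S[X_σ] → S[X_σ][1/h]` is injective. [folklore] -/
theorem algebraMap_away_injective_of_mem_nonZeroDivisors
    (hreg : h ∈ nonZeroDivisors (MvPolynomial σ S)) :
    Function.Injective (algebraMap (MvPolynomial σ S) (Localization.Away h)) :=
  IsLocalization.injective (Localization.Away h) (M := Submonoid.powers h)
    (Submonoid.powers_le.2 hreg)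

variable {h} in
/-- **The chart map is injective** (`h` a non-zero-divisor not involving the `X_i`, `i ∈ A`): the
substitution extends to a ring endomorphism `θ` of `S[X_σ][1/h]` (`h` is fixed, and a unit
there), and `θ ∘ hypBlowupChartMap` is the injective localisation map. [folklore] -/
theorem hypBlowupChartMap_injective (hh : ∀ i ∈ A, i ∉ h.vars)
    (hreg : h ∈ nonZeroDivisors (MvPolynomial σ S)) :
    Function.Injective (hypBlowupChartMap S A h) := by
  let g : MvPolynomial σ S →+* Localization.Away h :=
    (algebraMap (MvPolynomial σ S) (Localization.Away h)).comp (hypBlowupSubst S A h).toRingHom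
  have hg : IsUnit (g h) := by
    simp only [g, RingHom.coe_comp, Function.comp_apply, AlgHom.toRingHom_eq_coe,
      RingHom.coe_coe, hypBlowupSubst_self S A hh]
    exact IsLocalization.Away.algebraMap_isUnit h
  let θ : Localization.Away h →+* Localization.Away h := IsLocalization.Away.lift h hg
  have hθalg : ∀ q : MvPolynomial σ S,
      θ (algebraMap (MvPolynomial σ S) (Localization.Away h) q) =
        algebraMap (MvPolynomial σ S) (Localization.Away h) (hypBlowupSubst S A h q) :=
    fun q => IsLocalization.Away.lift_eq h hg q
  have hθinv : θ (Away.invSelf h) * algebraMap (MvPolynomial σ S) (Localization.Away h) h = 1 := by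
    have h1 : θ (algebraMap (MvPolynomial σ S) (Localization.Away h) h * Away.invSelf h) = 1 := by
      rw [Away.mul_invSelf, map_one]
    rw [map_mul, hθalg, hypBlowupSubst_self S A hh] at h1
    rwa [mul_comm] at h1
  have hθ : θ.comp (hypBlowupChartMap S A h).toRingHom =
      algebraMap (MvPolynomial σ S) (Localization.Away h) := by
    refine MvPolynomial.ringHom_ext (fun c => ?_) (fun i => ?_)
    · simp only [RingHom.coe_comp, Function.comp_apply, AlgHom.toRingHom_eq_coe, RingHom.coe_coe,
        hypBlowupChartMap_C, hθalg, hypBlowupSubst_C]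
    · simp only [RingHom.coe_comp, Function.comp_apply, AlgHom.toRingHom_eq_coe, RingHom.coe_coe]
      by_cases hi : i ∈ A
      · rw [hypBlowupChartMap_X_of_mem S A h hi, map_mul, hθalg, hypBlowupSubst_X_of_mem S A h hi,
          map_mul, mul_assoc, mul_comm (algebraMap (MvPolynomial σ S) (Localization.Away h) (X i)),
          ← mul_assoc, mul_comm (algebraMap (MvPolynomial σ S) (Localization.Away h) h),
          hθinv, one_mul]
      · rw [hypBlowupChartMap_X_of_not_mem S A h hi, hθalg, hypBlowupSubst_X_of_not_mem S A h hi]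
  intro p q hpq
  apply algebraMap_away_injective_of_mem_nonZeroDivisors S hreg
  have hp := congrArg (fun φ : MvPolynomial σ S →+* Localization.Away h => φ p) hθ
  have hq := congrArg (fun φ : MvPolynomial σ S →+* Localization.Away h => φ q) hθ
  simp only [RingHom.coe_comp, Function.comp_apply, AlgHom.toRingHom_eq_coe, RingHom.coe_coe] at hp hq
  rw [← hp, ← hq]
  exact congrArg θ hpq

/-- Every value of the chart map lies in the affine blowup algebra `S[X_σ][I/h]`.
[cite: GortzWedhorn2020, (13.19) p. 415] -/
theorem hypBlowupChartMap_mem (p : MvPolynomial σ S) :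
    hypBlowupChartMap S A h p ∈ blowupAlgebra (hypCentreIdeal S A h) h := by
  induction p using MvPolynomial.induction_on with
  | C c =>
    rw [hypBlowupChartMap_C]
    exact Subalgebra.algebraMap_mem _ _
  | add p q hp hq =>
    rw [map_add]
    exact Subalgebra.add_mem _ hp hq
  | mul_X p i hp =>
    rw [map_mul]
    refine Subalgebra.mul_mem _ hp ?_
    by_cases hi : i ∈ A
    · rw [hypBlowupChartMap_X_of_mem S A h hi]
      exact div_mem_blowupAlgebra _ _ (X_mem_hypCentreIdeal S A h hi)
    · rw [hypBlowupChartMap_X_of_not_mem S A h hi]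
      exact Subalgebra.algebraMap_mem _ _

variable {h} in
/-- **The image of the chart map is exactly the affine blowup algebra `S[X_σ][I/h]`** (the
generator `h/h = 1` is redundant). [cite: GortzWedhorn2020, (13.19) p. 415] [cite: StacksProject, Tag 052Q] -/
theorem range_hypBlowupChartMap (hh : ∀ i ∈ A, i ∉ h.vars) :
    Set.range (hypBlowupChartMap S A h) =
      (blowupAlgebra (hypCentreIdeal S A h) h : Set (Localization.Away h)) := by
  apply le_antisymm
  · rintro _ ⟨p, rfl⟩
    exact hypBlowupChartMap_mem S A h p
  · let B : Subalgebra (MvPolynomial σ S) (Localization.Away h) :=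
      { carrier := Set.range (hypBlowupChartMap S A h)
        mul_mem' := by
          rintro _ _ ⟨p, rfl⟩ ⟨q, rfl⟩
          exact ⟨p * q, map_mul _ _ _⟩
        one_mem' := ⟨1, map_one _⟩
        add_mem' := by
          rintro _ _ ⟨p, rfl⟩ ⟨q, rfl⟩
          exact ⟨p + q, map_add _ _ _⟩
        zero_mem' := ⟨0, map_zero _⟩
        algebraMap_mem' := fun r =>
          ⟨hypBlowupSubst S A h r, hypBlowupChartMap_hypBlowupSubst S A hh r⟩ }
    change (blowupAlgebra (hypCentreIdeal S A h) h : Set (Localization.Away h)) ⊆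
      (B : Set (Localization.Away h))
    have hle : blowupAlgebra (hypCentreIdeal S A h) h ≤ B := by
      refine Algebra.adjoin_le ?_
      rintro _ ⟨x, hx, rfl⟩
      -- `x ∈ (X_i : i ∈ A) + (h)`: write `x = y + z`
      obtain ⟨y, hy, z, hz, rfl⟩ := Submodule.mem_sup.mp hx
      rw [map_add, add_mul]
      refine B.add_mem ?_ ?_
      · refine Submodule.span_induction (p := fun x _ =>
          algebraMap (MvPolynomial σ S) (Localization.Away h) x * Away.invSelf h ∈ B) ?_ ?_ ?_ ?_ hy
        · rintro _ ⟨i, hi, rfl⟩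
          exact ⟨X i, hypBlowupChartMap_X_of_mem S A h hi⟩
        · rw [map_zero, zero_mul]
          exact B.zero_mem
        · intro x y _ _ hx hy
          rw [map_add, add_mul]
          exact B.add_mem hx hy
        · intro r x _ hx
          rw [smul_eq_mul, map_mul, mul_assoc]
          exact B.mul_mem (B.algebraMap_mem r) hx
      · obtain ⟨r, rfl⟩ := Ideal.mem_span_singleton'.mp hz
        rw [map_mul, mul_assoc, Away.mul_invSelf, mul_one]
        exact B.algebraMap_mem r
    exact hle

/-! ### The chart isomorphism `S[X_σ] ≅ S[X_σ][I/h]` -/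

/-- The chart map with values in the affine blowup algebra. [cite: GortzWedhorn2020, (13.19) p. 415] -/
def hypBlowupChartHom :
    MvPolynomial σ S →ₐ[S] blowupAlgebra (hypCentreIdeal S A h) h where
  toFun p := ⟨hypBlowupChartMap S A h p, hypBlowupChartMap_mem S A h p⟩
  map_one' := Subtype.ext (map_one _)
  map_mul' p q := Subtype.ext (map_mul _ _ _)
  map_zero' := Subtype.ext (map_zero _)
  map_add' p q := Subtype.ext (map_add _ _ _)
  commutes' c := Subtype.ext (by
    change hypBlowupChartMap S A h (algebraMap S (MvPolynomial σ S) c) =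
      algebraMap S (Localization.Away h) c
    rw [AlgHom.commutes])

/-- The underlying element of `hypBlowupChartHom p` is `hypBlowupChartMap p`. [folklore] -/
@[simp] theorem coe_hypBlowupChartHom_apply (p : MvPolynomial σ S) :
    (hypBlowupChartHom S A h p : Localization.Away h) = hypBlowupChartMap S A h p :=
  rfl

variable {h} in
/-- `hypBlowupChartHom` is bijective for `h` a non-zero-divisor free of the `X_i`, `i ∈ A`.
[cite: StacksProject, Tag 052Q] -/
theorem hypBlowupChartHom_bijective (hh : ∀ i ∈ A, i ∉ h.vars)
    (hreg : h ∈ nonZeroDivisors (MvPolynomial σ S)) :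
    Function.Bijective (hypBlowupChartHom S A h) := by
  refine ⟨fun p q hpq => hypBlowupChartMap_injective S A hh hreg (congrArg Subtype.val hpq),
    fun z => ?_⟩
  have hz : (z : Localization.Away h) ∈ Set.range (hypBlowupChartMap S A h) := by
    rw [range_hypBlowupChartMap S A hh]
    exact z.2
  obtain ⟨p, hp⟩ := hz
  exact ⟨p, Subtype.ext hp⟩

variable {h} in
/-- **The chart over `h` of the blow-up of `𝔸^σ_S` along `V(X_i : i ∈ A) ∩ V(h)` is the affine
space `𝔸^σ_S`**: `S[X_σ] ≅ S[X_σ][I/h]`, `X_i ↦ X_i/h` (`i ∈ A`), `X_j ↦ X_j` otherwise — the chart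
of Hu's `ℓ`-blow-up on which "`L_{𝔙,F} = 1 + sgn(s_F) y`" with `y` a free variable.
[cite: Hu2025, §2.5.4 and §8.3] [cite: StacksProject, Tag 052Q] -/
def hypBlowupChartEquiv (hh : ∀ i ∈ A, i ∉ h.vars) (hreg : h ∈ nonZeroDivisors (MvPolynomial σ S)) :
    MvPolynomial σ S ≃ₐ[S] blowupAlgebra (hypCentreIdeal S A h) h :=
  AlgEquiv.ofBijective (hypBlowupChartHom S A h) (hypBlowupChartHom_bijective S A hh hreg)

variable {h} in
/-- The underlying element of `hypBlowupChartEquiv p` is `hypBlowupChartMap p`. [folklore] -/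
@[simp] theorem coe_hypBlowupChartEquiv_apply (hh : ∀ i ∈ A, i ∉ h.vars)
    (hreg : h ∈ nonZeroDivisors (MvPolynomial σ S)) (p : MvPolynomial σ S) :
    (hypBlowupChartEquiv S A hh hreg p : Localization.Away h) = hypBlowupChartMap S A h p :=
  rfl

variable {h} in
/-- **Under the chart isomorphism the structure map of the chart is the substitution**:
`hypBlowupChartEquiv (hypBlowupSubst p) = p/1`. [cite: Hu2025, §5 Prop. 5.3] -/
theorem hypBlowupChartEquiv_hypBlowupSubst (hh : ∀ i ∈ A, i ∉ h.vars)
    (hreg : h ∈ nonZeroDivisors (MvPolynomial σ S)) (p : MvPolynomial σ S) :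
    hypBlowupChartEquiv S A hh hreg (hypBlowupSubst S A h p) =
      algebraMap (MvPolynomial σ S) (blowupAlgebra (hypCentreIdeal S A h) h) p :=
  Subtype.ext (hypBlowupChartMap_hypBlowupSubst S A hh p)

variable {h} in
/-- Equivalently: the inverse chart isomorphism restricted to `S[X_σ]` is the substitution.
[cite: Hu2025, §5 Prop. 5.3] -/
theorem hypBlowupChartEquiv_symm_algebraMap (hh : ∀ i ∈ A, i ∉ h.vars)
    (hreg : h ∈ nonZeroDivisors (MvPolynomial σ S)) (p : MvPolynomial σ S) :
    (hypBlowupChartEquiv S A hh hreg).symm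
      (algebraMap (MvPolynomial σ S) (blowupAlgebra (hypCentreIdeal S A h) h) p) =
      hypBlowupSubst S A h p := by
  rw [← hypBlowupChartEquiv_hypBlowupSubst S A hh hreg, AlgEquiv.symm_apply_apply]

/-! ### The chart ring of `Proj R[It]` -/

variable {h} in
/-- **The chart ring `(R[It])_{(h t)}` of `Proj R[It]`, `R = S[X_σ]`, `I = (X_i : i ∈ A) + (h)`, is
the polynomial ring `S[X_σ]`.** [cite: StacksProject, Tag 0804] [cite: Hu2025, §2.5.4] -/
def hypBlowupReesChartEquiv (hh : ∀ i ∈ A, i ∉ h.vars)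
    (hreg : h ∈ nonZeroDivisors (MvPolynomial σ S)) :
    HomogeneousLocalization.Away (reesGrading (hypCentreIdeal S A h))
        (reesT h (self_mem_hypCentreIdeal S A h)) ≃+* MvPolynomial σ S :=
  (reesChartEquiv h (self_mem_hypCentreIdeal S A h)).trans
    (hypBlowupChartEquiv S A hh hreg).symm.toRingEquiv

variable {h} in
/-- Under `hypBlowupReesChartEquiv` the structure map `reesChartBase` of the chart is the
substitution `hypBlowupSubst`. [cite: Hu2025, §5 Prop. 5.3] -/
theorem hypBlowupReesChartEquiv_reesChartBase (hh : ∀ i ∈ A, i ∉ h.vars)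
    (hreg : h ∈ nonZeroDivisors (MvPolynomial σ S)) (r : MvPolynomial σ S) :
    hypBlowupReesChartEquiv S A hh hreg
      (reesChartBase h (self_mem_hypCentreIdeal S A h) r) = hypBlowupSubst S A h r := by
  rw [hypBlowupReesChartEquiv, RingEquiv.trans_apply, reesChartEquiv_reesChartBase]
  exact hypBlowupChartEquiv_symm_algebraMap S A hh hreg r

/-! ### Hu's bookkeeping on this chart: `L = c δ + h` -/

variable {h} in
/-- **`π* L = h · (c y + 1)`** for `L = c X_{j₀} + h`, `j₀ ∈ A`: on the chart over `L` (= over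
`h`) the proper transform of `L` is `1 + c y`, `y = X_{j₀}` the new free variable ("we can
choose the chart `𝔙` such that `L_{𝔙,F} = 1 + sgn(s_F) y_{𝔙,(𝔪,u_F)}`"), and `h` is the
exceptional parameter. [cite: Hu2025, §8.3 and §2.5.4] -/
theorem hypBlowupSubst_C_mul_X_add (hh : ∀ i ∈ A, i ∉ h.vars) {j₀ : σ} (hj₀ : j₀ ∈ A) (c : S) :
    hypBlowupSubst S A h (C c * X j₀ + h) = h * (C c * X j₀ + 1) := by
  rw [map_add, map_mul, hypBlowupSubst_C, hypBlowupSubst_X_of_mem S A h hj₀,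
    hypBlowupSubst_self S A hh]
  ring

/-- **"This process separates the two divisors"**: the proper transform `(y = 0)` of
`(δ = 0)` and the proper transform `(c y + 1 = 0)` of `(L = 0)` do not meet on the chart:
`(X_{j₀}) + (c X_{j₀} + 1) = (1)`. [cite: Hu2025, §2.5.4] -/
theorem span_X_sup_span_C_mul_X_add_one_eq_top (j₀ : σ) (c : S) :
    Ideal.span {(X j₀ : MvPolynomial σ S)} ⊔ Ideal.span {C c * X j₀ + 1} = ⊤ := by
  rw [Ideal.eq_top_iff_one, Submodule.mem_sup]
  refine ⟨-(C c * X j₀), ?_, C c * X j₀ + 1, Ideal.subset_span rfl, by ring⟩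
  rw [Ideal.mem_span_singleton']
  exact ⟨-C c, by ring⟩

/-- On the proper transform `(c y + 1 = 0)` of `(L = 0)` the new variable `y` is a unit
("bring up a variable `y_{(𝔪,u_{F_k})}` invertible along `Ṽ_{ℓ_k}`"): `y · (-c) = 1` modulo
`c y + 1`. [cite: Hu2025, §2.5.4] -/
theorem isUnit_mk_X_of_C_mul_X_add_one {j₀ : σ} (c : S) :
    IsUnit (Ideal.Quotient.mk (Ideal.span {C c * X j₀ + 1}) (X j₀ : MvPolynomial σ S)) := by
  refine IsUnit.of_mul_eq_one (Ideal.Quotient.mk _ (-C c)) ?_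
  rw [← map_mul, ← (Ideal.Quotient.mk _).map_one, Ideal.Quotient.eq, Ideal.mem_span_singleton']
  exact ⟨-1, by ring⟩

end Literature.AlgebraicGeometry.Resolution

end
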